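import Summits.BirchSwinnertonDyer.BirchSwinnertonDyer.Theorems.KolyvaginRoadThreeSchneiderTamAtThreeHeightLogNumeratorDeepSeries
import Summits.BirchSwinnertonDyer.BirchSwinnertonDyer.Theorems.KolyvaginRoadThreeSchneiderTamAtThreeHeightLogNumeratorSecondOrderCore
import Summits.BirchSwinnertonDyer.BirchSwinnertonDyer.Theorems.ClassRecordThreeRegCertKernelO2Log
import HarnessLib

/-!
# Crux `SchneiderTamAtThree` (item 19154) — THE HEIGHT IS THE LOGARITHM OF THE NUMERATOR, DEEP POINTS,
# part 5: the uniformisation scale to SECOND order in the Tate parameter, `C⁻² = −(c₆/c₄)(1 + 744q) + O(3⁻¹q²)`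

HONEST FRAMING (cell `bsd-stepL`, seat `bsd-stepL-tam3-p2` g2, WIDTH-LEVER second lane «closed-form Schneider
local factor at 3 … finite case table proved once»; `--supports stmt-BirchSwinnertonDyer-19154 --as helper`):
THEOREMS ONLY, unconditional, route-independent (no Theses import); 0 definitions, 0 named facts, 0 sorry;
nothing here proves the crux `SchneiderTamAtThree`, Schneider's conjecture or BSD. Input of the REFINED
deep-point law (part 6, precision `2k + min(2k, ν+1)` — the extra digit that kit j285773 observes on all
690 rows of lane A's table): the two `O(q)` terms of the height, from `C⁻²` (here) and from the sigma product
`Π = 1 − 4q(ch L − 1) + O(q²)` (lane A's `KernelCert.norm_tprod_tateSigmaSq_factor_sub_linear_le`), combine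
into `−60·(c₆/c₄)·q·x⁻¹`, and `3 ∣ 60`.

* `norm_inv_scaleSq_sub_linear_le` — **`‖C⁻² − (−c₆/c₄)·(1 + 744q)‖₃ ≤ 3⁻¹‖q‖₃²`** for `W` globally
  minimal with multiplicative reduction at `3` and `‖q‖₃ < 1`: `C⁻² = −(c₆/c₄)·(1 + 240s₃(q))/(1 − 504s₅(q))`
  (`C² = c₆(E_q)c₄/(c₄(E_q)c₆)`, `c₄(E_q) = 1 + 240s₃`, `c₆(E_q) = −(1 − 504s₅)`), `s_k(q) = q + O(q²)`
  (lane A's `KernelCert.norm_tateS_sub_self_le`), `240 + 504 = 744`, and `3 ∣ 240, 504`.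
* `norm_kappa_add_sub_linear_le` — consequently **`‖(C⁻² − b₂)/12 + (b₂b₄ − 18b₆)/c₄ + 62(c₆/c₄)q‖₃ ≤ ‖q‖₃²`**
  (part 1 §4 gave `≤ ‖q‖`): the `q`-linear digit of `κ`.
* `norm_padicLog_one_add_sub_le_sq` — `‖log₃(1+u) − u‖₃ ≤ ‖u‖₃²` for `‖u‖₃ ≤ 3⁻¹`.
* `norm_two_mul_coshOfSq_sub_one_sub_le` — `‖2(ch L − 1) − L‖₃ ≤ 3‖L‖₃²` for `‖L‖₃ ≤ 3⁻²`.

References: [SilvermanATAEC1994] V.3 (Tate curve, `E₄, E₆`); [SteinWuthrich2013] §4.2; [Iwasawa1972PadicL] §4.4;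
tree: deep part 1, `…SecondOrderSeries`, lane A `ClassRecordThreeRegCertKernelO2Log` (`s_k(q) − q = O(q²)`).
-/

noncomputable section

open scoped Classical Nat
open Filter Topology IsUltrametricDist PowerSeries
open WeierstrassCurve Literature.NumberTheory.EllipticCurves
open Literature.NumberTheory.EllipticCurves.SteinWuthrich2013
open Literature.NumberTheory.EllipticCurves.TateCurve
open Literature.NumberTheory.EllipticCurves.Rank1Residual
open Summit.BirchSwinnertonDyer.Uniform.UI.O2

namespace Summit.BirchSwinnertonDyer.Rank1Residual.X11b.RegMult.HeightLogNumerator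

/-! ### §11 The scale to second order in `q` -/

section Scale

variable {W : WeierstrassCurve ℚ}

/-- **`C⁻² = −(c₆/c₄)·(1 + 744q) + O(3⁻¹q²)`.** For `W/ℚ` globally minimal with multiplicative reduction at
`3` and `‖q‖₃ < 1`: `‖(uniformisationScaleSq W 3 q)⁻¹ − (−c₆/c₄)(1 + 744q)‖₃ ≤ 3⁻¹‖q‖₃²` (`c₄, c₆` of
`W/ℚ₃`). Proof: `C⁻² = −(c₆/c₄)(1 + 240s₃)/(1 − 504s₅)` and
`(1 + 240s₃) − (1 + 744q)(1 − 504s₅) = 240(s₃ − q) + 504(s₅ − q) + 744·504·q·s₅`, each of norm `≤ 3⁻¹‖q‖²`;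
`‖1 − 504s₅‖ = 1`. [cite: SilvermanATAEC1994, Thm. V.3.1 (b)] -/
theorem norm_inv_scaleSq_sub_linear_le [W.IsElliptic] [W.IsGloballyMinimal] (hW : Mult W 3)
    {q : ℚ_[3]} (hq : ‖q‖ < 1) :
    ‖(uniformisationScaleSq W 3 q)⁻¹ -
        -((W.baseChange ℚ_[3]).c₆ / (W.baseChange ℚ_[3]).c₄) * (1 + 744 * q)‖ ≤ 3⁻¹ * ‖q‖ ^ 2 := by
  set V := W.baseChange ℚ_[3] with hVdef
  obtain ⟨hc4W, hc6W⟩ := norm_c₄_c₆_baseChange_eq_one (W := W) hW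
  have h12 : (12 : ℚ_[3]) ≠ 0 := by norm_num
  have hq1 : ‖q‖ ≤ 1 := hq.le
  have hc4q : (tateCurve q).c₄ = 1 + 240 * tateS 3 q := by rw [tateCurve_c₄, tateE4_eq]
  have hc6q : (tateCurve q).c₆ = -(1 - 504 * tateS 5 q) := by rw [tateCurve_c₆ h12, tateE6]
  have hS3 : ‖tateS 3 q - q‖ ≤ ‖q‖ ^ 2 := KernelCert.norm_tateS_sub_self_le 3 hq
  have hS5 : ‖tateS 5 q - q‖ ≤ ‖q‖ ^ 2 := KernelCert.norm_tateS_sub_self_le 5 hq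
  have hS5n : ‖tateS 5 q‖ ≤ ‖q‖ := norm_tateS_le hq1
  have h3n : ‖(3 : ℚ_[3])‖ = 1 / 3 := by
    rw [show (3 : ℚ_[3]) = ((3 : ℕ) : ℚ_[3]) by norm_cast, Padic.norm_p]; norm_num
  have h240 : ‖(240 : ℚ_[3])‖ ≤ 1 / 3 := by
    rw [show (240 : ℚ_[3]) = ((80 : ℤ) : ℚ_[3]) * 3 by norm_num, norm_mul, h3n]
    calc ‖((80 : ℤ) : ℚ_[3])‖ * (1 / 3) ≤ 1 * (1 / 3) := by gcongr; exact Padic.norm_int_le_one 80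
      _ = 1 / 3 := one_mul _
  have h504 : ‖(504 : ℚ_[3])‖ ≤ 1 / 3 := by
    rw [show (504 : ℚ_[3]) = ((168 : ℤ) : ℚ_[3]) * 3 by norm_num, norm_mul, h3n]
    calc ‖((168 : ℤ) : ℚ_[3])‖ * (1 / 3) ≤ 1 * (1 / 3) := by gcongr; exact Padic.norm_int_le_one 168
      _ = 1 / 3 := one_mul _
  have h744 : ‖(744 : ℚ_[3])‖ ≤ 1 := by
    have h : ((744 : ℤ) : ℚ_[3]) = 744 := by norm_cast
    rw [← h]; exact Padic.norm_int_le_one 744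
  have hc6q1 : ‖(tateCurve q).c₆‖ = 1 := norm_c₆_tateCurve_eq_one hq
  have hD1 : ‖1 - 504 * tateS 5 q‖ = 1 := by
    have e : 1 - 504 * tateS 5 q = -(tateCurve q).c₆ := by rw [hc6q, neg_neg]
    rw [e, norm_neg, hc6q1]
  have hD0 : 1 - 504 * tateS 5 q ≠ 0 := norm_pos_iff.mp (by rw [hD1]; exact one_pos)
  have hc4W0 : V.c₄ ≠ 0 := norm_pos_iff.mp (by rw [hc4W]; exact one_pos)
  have hc6W0 : V.c₆ ≠ 0 := norm_pos_iff.mp (by rw [hc6W]; exact one_pos)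
  have hc4q0 : (tateCurve q).c₄ ≠ 0 := by
    intro h
    have h' : ‖1 + 240 * tateS 3 q‖ = 1 := by
      rw [show 1 + 240 * tateS 3 q = 240 * tateS 3 q + 1 by ring]
      refine norm_add_eq_max_of_norm_ne_norm ?_ |>.trans ?_
      · rw [norm_one]; refine ne_of_lt ?_
        calc ‖240 * tateS 3 q‖ = ‖(240 : ℚ_[3])‖ * ‖tateS 3 q‖ := norm_mul _ _
          _ ≤ (1 / 3) * ‖q‖ := by gcongr; exact norm_tateS_le hq1
          _ < 1 := by linarith
      · rw [norm_one]; refine max_eq_right ?_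
        calc ‖240 * tateS 3 q‖ = ‖(240 : ℚ_[3])‖ * ‖tateS 3 q‖ := norm_mul _ _
          _ ≤ (1 / 3) * ‖q‖ := by gcongr; exact norm_tateS_le hq1
          _ ≤ 1 := by linarith
    rw [← hc4q, h, norm_zero] at h'
    exact zero_ne_one h'
  have hCdef : uniformisationScaleSq W 3 q = (tateCurve q).c₆ * V.c₄ / ((tateCurve q).c₄ * V.c₆) := rfl
  -- the exact rearrangement
  have e : (uniformisationScaleSq W 3 q)⁻¹ - -(V.c₆ / V.c₄) * (1 + 744 * q) =
      -(V.c₆ / V.c₄) * ((240 * (tateS 3 q - q) + 504 * (tateS 5 q - q) + 744 * 504 * (q * tateS 5 q)) /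
        (1 - 504 * tateS 5 q)) := by
    rw [hCdef, inv_div, hc4q, hc6q]
    field_simp
    ring
  rw [e, norm_mul, norm_neg, norm_div, hc6W, hc4W, div_one, one_mul, norm_div, hD1, div_one]
  refine (norm_add_le_max _ _).trans (max_le ((norm_add_le_max _ _).trans (max_le ?_ ?_)) ?_)
  · rw [norm_mul]
    calc ‖(240 : ℚ_[3])‖ * ‖tateS 3 q - q‖ ≤ (1 / 3) * ‖q‖ ^ 2 := by gcongr
      _ = 3⁻¹ * ‖q‖ ^ 2 := by norm_num
  · rw [norm_mul]
    calc ‖(504 : ℚ_[3])‖ * ‖tateS 5 q - q‖ ≤ (1 / 3) * ‖q‖ ^ 2 := by gcongr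
      _ = 3⁻¹ * ‖q‖ ^ 2 := by norm_num
  · rw [norm_mul, norm_mul, norm_mul]
    calc ‖(744 : ℚ_[3])‖ * ‖(504 : ℚ_[3])‖ * (‖q‖ * ‖tateS 5 q‖) ≤ 1 * (1 / 3) * (‖q‖ * ‖q‖) := by gcongr
      _ = 3⁻¹ * ‖q‖ ^ 2 := by ring

/-- **The `q`-linear digit of `κ`: `‖(C⁻² − b₂)/12 + (b₂b₄ − 18b₆)/c₄ + 62(c₆/c₄)q‖₃ ≤ ‖q‖₃²`** (refines
part 1 §4's `≤ ‖q‖`): with `C₀ = −c₆/c₄`, `(C₀ − b₂)/12 = (18b₆ − b₂b₄)/c₄` identically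
(`c₆ = −b₂³ + 36b₂b₄ − 216b₆`, `c₄ = b₂² − 24b₄`), `(C⁻² − C₀)/12 = 62C₀q + O(3·3⁻¹q²)`.
[cite: SilvermanATAEC1994, Thm. V.3.1 (b)] -/
theorem norm_kappa_add_sub_linear_le [W.IsElliptic] [W.IsGloballyMinimal] (hW : Mult W 3) {q : ℚ_[3]}
    (hq : ‖q‖ < 1) :
    ‖((uniformisationScaleSq W 3 q)⁻¹ - (W.baseChange ℚ_[3]).b₂) / 12 +
        ((W.baseChange ℚ_[3]).b₂ * (W.baseChange ℚ_[3]).b₄ - 18 * (W.baseChange ℚ_[3]).b₆) /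
          (W.baseChange ℚ_[3]).c₄ +
        62 * ((W.baseChange ℚ_[3]).c₆ / (W.baseChange ℚ_[3]).c₄) * q‖ ≤ ‖q‖ ^ 2 := by
  set V := W.baseChange ℚ_[3] with hVdef
  obtain ⟨hc4W, -⟩ := norm_c₄_c₆_baseChange_eq_one (W := W) hW
  have hc4W0 : V.c₄ ≠ 0 := norm_pos_iff.mp (by rw [hc4W]; exact one_pos)
  have h12i : ‖(12 : ℚ_[3])⁻¹‖ = 3 := by
    have h4n : ‖(4 : ℚ_[3])‖ = 1 := by
      simpa using Padic.norm_natCast_eq_one_iff.mpr (show Nat.Coprime 3 4 by decide)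
    rw [show (12 : ℚ_[3]) = 4 * 3 by norm_num, mul_inv, norm_mul, norm_inv, norm_inv, h4n,
      show (3 : ℚ_[3]) = ((3 : ℕ) : ℚ_[3]) by norm_cast, Padic.norm_p]; norm_num
  have hc4b : V.c₄ = V.b₂ ^ 2 - 24 * V.b₄ := rfl
  have hc6b : V.c₆ = -V.b₂ ^ 3 + 36 * V.b₂ * V.b₄ - 216 * V.b₆ := rfl
  have h := norm_inv_scaleSq_sub_linear_le hW hq
  have e : ((uniformisationScaleSq W 3 q)⁻¹ - V.b₂) / 12 + (V.b₂ * V.b₄ - 18 * V.b₆) / V.c₄ +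
      62 * (V.c₆ / V.c₄) * q =
      (12 : ℚ_[3])⁻¹ * ((uniformisationScaleSq W 3 q)⁻¹ - -(V.c₆ / V.c₄) * (1 + 744 * q)) := by
    field_simp
    rw [hc6b, hc4b]
    ring
  rw [e, norm_mul, h12i]
  calc 3 * _ ≤ 3 * (3⁻¹ * ‖q‖ ^ 2) := by gcongr
    _ = ‖q‖ ^ 2 := by ring

end Scale

/-! ### §12 Two small expansions -/

/-- `‖log₃(1 + u) − u‖₃ ≤ ‖u‖₃²` for `‖u‖₃ ≤ 3⁻¹` (`log(1+u) = u − u²/2 + O(3‖u‖³)`, `‖½‖₃ = 1`,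
`3‖u‖ ≤ 1`). [cite: Iwasawa1972PadicL, §4.4] -/
theorem norm_padicLog_one_add_sub_le_sq {u : ℚ_[3]} (hu : ‖u‖ ≤ 1 / 3) :
    ‖padicLog 3 (1 + u) - u‖ ≤ ‖u‖ ^ 2 := by
  have h := norm_padicLog_one_add_sub_sub_le hu
  have h2n : ‖(2 : ℚ_[3])‖ = 1 := by
    simpa using Padic.norm_natCast_eq_one_iff.mpr (show Nat.Coprime 3 2 by decide)
  have e : padicLog 3 (1 + u) - u = (padicLog 3 (1 + u) - (u - u ^ 2 / 2)) - u ^ 2 / 2 := by ring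
  rw [e]
  refine (norm_sub_le_max₃ _ _).trans (max_le (h.trans ?_) ?_)
  · calc 3 * ‖u‖ ^ 3 = (3 * ‖u‖) * ‖u‖ ^ 2 := by ring
      _ ≤ 1 * ‖u‖ ^ 2 := by gcongr; linarith
      _ = ‖u‖ ^ 2 := one_mul _
  · rw [norm_div, h2n, div_one, norm_pow]

/-- `‖2(ch L − 1) − L‖₃ ≤ 3‖L‖₃²` for `‖L‖₃ ≤ 3⁻²` (`2(ch L − 1) = L + L²/12 + L³/360 + O(9L⁴)`,
`‖1/12‖₃ = 3`). [cite: Iwasawa1972PadicL, §4.4] -/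
theorem norm_two_mul_coshOfSq_sub_one_sub_le {L : ℚ_[3]} (hL : ‖L‖ ≤ 1 / 9) :
    ‖2 * (coshOfSq L - 1) - L‖ ≤ 3 * ‖L‖ ^ 2 := by
  obtain ⟨h2n, h4n, h3n, h3i, h9i, h12i, h360i, -, -, -⟩ := padic_three_constants
  have hD := norm_two_mul_coshOfSq_sub_cubic_le hL
  have e : 2 * (coshOfSq L - 1) - L =
      (2 * (coshOfSq L - 1) - L - L ^ 2 / 12 - L ^ 3 / 360) + L ^ 2 / 12 + L ^ 3 / 360 := by ring
  rw [e]
  have hL1 : ‖L‖ ≤ 1 := hL.trans (by norm_num)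
  refine (norm_add_le_max _ _).trans (max_le ((norm_add_le_max _ _).trans (max_le (hD.trans ?_) ?_)) ?_)
  · calc 9 * ‖L‖ ^ 4 = (9 * ‖L‖ ^ 2) * ‖L‖ ^ 2 := by ring
      _ ≤ (9 * (1 / 9) ^ 2) * ‖L‖ ^ 2 := by gcongr
      _ ≤ 3 * ‖L‖ ^ 2 := by nlinarith [sq_nonneg ‖L‖]
  · rw [div_eq_mul_inv, norm_mul, h12i, norm_pow, mul_comm]
  · rw [div_eq_mul_inv, norm_mul, h360i, norm_pow]
    calc ‖L‖ ^ 3 * 9 = (9 * ‖L‖) * ‖L‖ ^ 2 := by ring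
      _ ≤ (9 * (1 / 9)) * ‖L‖ ^ 2 := by gcongr
      _ ≤ 3 * ‖L‖ ^ 2 := by nlinarith [sq_nonneg ‖L‖]

end Summit.BirchSwinnertonDyer.Rank1Residual.X11b.RegMult.HeightLogNumerator

end
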